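import Literature.AlgebraicGeometry.Resolution.AlterationsResolution
import Literature.AlgebraicGeometry.Resolution.NormalizationOfVarieties
import Mathlib.AlgebraicGeometry.Morphisms.IsIso
import Mathlib.AlgebraicGeometry.Morphisms.Integral
import Mathlib.AlgebraicGeometry.Morphisms.SchemeTheoreticallyDominant
import Mathlib.RingTheory.IntegralClosure.IntegrallyClosed
import HarnessLib

/-!
# A finite birational morphism onto a normal scheme is an isomorphism

Topic: `Literature/AlgebraicGeometry/Resolution`. The classical remark used three times in the
proof of de Jong 1996, Thm. 4.1 — 4.16: "`Z'₁ → Y'` finite and birational. […] Thus `Z'₁ → Y'`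
is an isomorphism as `Y'` is normal"; 4.20: "we may assume that `V` is normal. Thus the finite
birational morphism `pr₂⁻¹(V) → V` is an isomorphism"; 4.21: "`𝒞` is a normal scheme […] Thus
the birational finite morphism `pr₁ : T → 𝒞` is an isomorphism" — PROVED:

**Theorem** (`isIso_of_isIntegralHom_of_isBirational`). Let `f : X → Y` be an integral (e.g.
finite) birational morphism of integral schemes with `Y` normal (all local rings integrally
closed). Then `f` is an isomorphism.

Proof. Being an isomorphism is local on `Y`; over a non-empty affine open `V = Spec A` (`A` a
normal domain: its localisations at maximal ideals are local rings of `Y`,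
`IsIntegrallyClosed.of_localization_maximal`) the preimage is `Spec B`, `A → B` injective (`f` is
dominant, `Y` reduced) and integral. Birationality makes the stalk map at the generic point an
isomorphism `K(Y) ≅ K(X)` compatible with `A → B → K(X)`, so `K(X)` is a fraction field of `A`;
every `b ∈ B`, being integral over `A` inside `Frac A`, lies in `A`. Hence `A → B` is bijective,
`f` is an isomorphism over `V` (`isIso_morphismRestrict_of_isIso_app`), and over `Y`.

## Sources

* A. J. de Jong, *Smoothness, semi-stability and alterations*, Publ. Math. IHÉS 83 (1996), 4.16
  (p. 71), 4.20–4.21 (pp. 73–74).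
* The Stacks Project, Tag 0AB1 (cf. Tag 035Q: a finite birational morphism to a normal integral
  scheme is an isomorphism); Q. Liu, *Algebraic Geometry and Arithmetic Curves* (2002),
  Cor. 4.4.3 (b) / Def. 4.1.24.
-/

noncomputable section

open CategoryTheory CategoryTheory.Limits AlgebraicGeometry TopologicalSpace Topology

namespace Literature.AlgebraicGeometry.Resolution

universe u

/-! ## Isomorphisms of affine morphisms are detected on sections over affine opens -/

/-- An affine morphism which induces an isomorphism on sections over an affine open `U` of the
target restricts to an isomorphism `f⁻¹(U) ≅ U`. [folklore] -/
theorem isIso_morphismRestrict_of_isIso_app {X Y : Scheme.{u}} (f : X ⟶ Y) [IsAffineHom f]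
    {U : Y.Opens} (hU : IsAffineOpen U) [IsIso (f.app U)] : IsIso (f ∣_ U) := by
  haveI : IsAffine U := hU
  have h : MorphismProperty.isomorphisms Scheme (f ∣_ U) := by
    rw [HasAffineProperty.iff_of_isAffine (P := MorphismProperty.isomorphisms Scheme)]
    refine ⟨hU.preimage f, ?_⟩
    rw [morphismRestrict_appTop]
    have h1 : IsIso (f.app (U.ι ''ᵁ ⊤)) := by
      rw [Scheme.Opens.ι_image_top]
      infer_instance
    have h2 : IsIso (X.presheaf.map (eqToHom (image_morphismRestrict_preimage f U ⊤)).op) := by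
      rw [eqToHom_op, eqToHom_map]
      infer_instance
    exact @IsIso.comp_isIso _ _ _ _ _ _ _ h1 h2
  exact (MorphismProperty.isomorphisms.iff _).mp h

/-! ## The stalk map at the generic point of a birational morphism -/

/-- For a birational morphism of integral schemes the stalk map at the generic point — the map
of function fields `K(Y) = 𝒪_{Y,f(η_X)} → 𝒪_{X,η_X} = K(X)` — is an isomorphism.
[folklore] -/
theorem IsBirational.isIso_stalkMap_genericPoint {X Y : Scheme.{u}} [IsIntegral X] {f : X ⟶ Y}
    (hf : IsBirational f) : IsIso (f.stalkMap (genericPoint X)) := by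
  obtain ⟨U, -, hU', hiso⟩ := hf
  haveI := hiso
  have hη : genericPoint X ∈ f ⁻¹ᵁ U :=
    ((genericPoint_spec X).mem_open_set_iff (f ⁻¹ᵁ U).isOpen).mpr (by simpa using hU'.nonempty)
  exact ((MorphismProperty.isomorphisms CommRingCat).arrow_mk_iso_iff
    (morphismRestrictStalkMap f U ⟨genericPoint X, hη⟩)).mp
      ((MorphismProperty.isomorphisms.iff _).mpr inferInstance)

/-! ## The coordinate ring of a non-empty affine open of a normal integral scheme is integrally
closed -/

/-- If all local rings of the integral scheme `Y` are integrally closed, then so is the ring of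
sections over every non-empty affine open (its localisations at maximal ideals are local rings
of `Y`, and being integrally closed is a local property,
`IsIntegrallyClosed.of_localization_maximal`). [folklore] -/
theorem isIntegrallyClosed_sections_of_stalk {Y : Scheme.{u}} [IsIntegral Y]
    (hY : ∀ y : Y, IsIntegrallyClosed (Y.presheaf.stalk y)) (V : Y.affineOpens)
    [Nonempty (V : Y.Opens)] : IsIntegrallyClosed Γ(Y, V) := by
  refine IsIntegrallyClosed.of_localization_maximal fun 𝔭 _ h𝔭 => ?_
  let q : PrimeSpectrum Γ(Y, V) := ⟨𝔭, h𝔭.isPrime⟩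
  have hq : V.2.fromSpec q ∈ (V : Y.Opens) := by
    have h : V.2.fromSpec q ∈ Set.range V.2.fromSpec := ⟨q, rfl⟩
    rw [V.2.range_fromSpec] at h
    exact h
  letI := TopCat.Presheaf.algebra_section_stalk Y.presheaf (⟨V.2.fromSpec q, hq⟩ : (V : Y.Opens))
  haveI : IsLocalization.AtPrime (Y.presheaf.stalk (V.2.fromSpec q)) 𝔭 :=
    V.2.isLocalization_stalk' q hq
  haveI := hY (V.2.fromSpec q)
  exact IsIntegrallyClosed.of_equiv (IsLocalization.algEquiv 𝔭.primeCompl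
    (Y.presheaf.stalk (V.2.fromSpec q)) (Localization.AtPrime 𝔭)).toRingEquiv

/-! ## The theorem -/

/-- The affine-local heart of `isIso_of_isIntegralHom_of_isBirational`: over a non-empty affine
open `V` of the normal integral `Y`, an integral dominant morphism from an integral scheme
whose stalk map at the generic point is an isomorphism restricts to an isomorphism.
[folklore] -/
theorem isIso_morphismRestrict_of_isIntegralHom_of_isIso_stalkMap {X Y : Scheme.{u}}
    [IsIntegral X] [IsIntegral Y] (f : X ⟶ Y) [IsIntegralHom f] [IsDominant f]
    (hY : ∀ y : Y, IsIntegrallyClosed (Y.presheaf.stalk y))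
    (hstalk : IsIso (f.stalkMap (genericPoint X))) (V : Y.affineOpens)
    [hVne : Nonempty (V : Y.Opens)] : IsIso (f ∣_ (V : Y.Opens)) := by
  haveI : IsSchemeTheoreticallyDominant f := .of_isDominant f
  haveI := hstalk
  have hfη : f (genericPoint X) = genericPoint Y := genericPoint_eq_of_isDominant f
  have hηV : genericPoint Y ∈ (V : Y.Opens) :=
    ((genericPoint_spec Y).mem_open_set_iff (V : Y.Opens).isOpen).mpr
      (by obtain ⟨y⟩ := hVne; exact ⟨y.1, Set.mem_univ _, y.2⟩)
  have hξV : genericPoint X ∈ f ⁻¹ᵁ (V : Y.Opens) := by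
    show f (genericPoint X) ∈ (V : Y.Opens)
    rw [hfη]
    exact hηV
  haveI : Nonempty ↥(f ⁻¹ᵁ (V : Y.Opens)) := ⟨⟨_, hξV⟩⟩
  haveI : Nonempty ((f ⁻¹ᵁ (V : Y.Opens) : X.Opens) : Scheme.{u}) := ⟨⟨_, hξV⟩⟩
  -- `A = Γ(Y, V) → B = Γ(X, f⁻¹ V) → K(X)`
  letI algAB : Algebra Γ(Y, V) Γ(X, f ⁻¹ᵁ V) := (f.app V).hom.toAlgebra
  letI algAK : Algebra Γ(Y, V) X.functionField :=
    ((X.germToFunctionField (f ⁻¹ᵁ V)).hom.comp (f.app V).hom).toAlgebra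
  haveI : IsScalarTower Γ(Y, V) Γ(X, f ⁻¹ᵁ V) X.functionField :=
    IsScalarTower.of_algebraMap_eq (R := Γ(Y, V)) (S := Γ(X, f ⁻¹ᵁ V)) (A := X.functionField)
      fun a => rfl
  -- `K(Y) ≅ K(X)` under `A`
  let e0 : Y.presheaf.stalk (genericPoint Y) ≅ X.functionField :=
    Y.presheaf.stalkCongr (.of_eq hfη.symm) ≪≫ asIso (f.stalkMap (genericPoint X))
  have hsp : f (genericPoint X) ⤳ genericPoint Y := by rw [hfη]
  have he0 : ∀ a : Γ(Y, V), e0.hom (Y.germToFunctionField V a) =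
      X.germToFunctionField (f ⁻¹ᵁ V) (f.app V a) := fun a => by
    show (Y.presheaf.germ V (genericPoint Y) hηV ≫
      Y.presheaf.stalkSpecializes hsp ≫ f.stalkMap (genericPoint X)) a =
        (f.app V ≫ X.presheaf.germ (f ⁻¹ᵁ V) (genericPoint X) hξV) a
    rw [TopCat.Presheaf.germ_stalkSpecializes_assoc, Scheme.Hom.germ_stalkMap]
  let eA : Y.functionField ≃ₐ[Γ(Y, V)] X.functionField :=
    { e0.commRingCatIsoToRingEquiv with
      commutes' := fun a => he0 a }
  haveI : IsFractionRing Γ(Y, V) Y.functionField :=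
    functionField_isFractionRing_of_isAffineOpen Y V V.2
  haveI : IsFractionRing Γ(Y, V) X.functionField :=
    IsLocalization.isLocalization_of_algEquiv (nonZeroDivisors Γ(Y, V)) eA
  -- `A` is integrally closed, `A → B` integral and injective, hence bijective
  haveI : IsIntegrallyClosed Γ(Y, V) := isIntegrallyClosed_sections_of_stalk hY V
  have hint : (f.app V).hom.IsIntegral := f.isIntegral_app V V.2
  have hinj : Function.Injective (f.app V) := f.app_injective V
  have hsurj : Function.Surjective (f.app V) := fun b => by
    have hb : IsIntegral Γ(Y, V) (algebraMap Γ(X, f ⁻¹ᵁ V) X.functionField b) :=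
      (show IsIntegral Γ(Y, V) b from hint b).map
        (IsScalarTower.toAlgHom Γ(Y, V) Γ(X, f ⁻¹ᵁ V) X.functionField)
    obtain ⟨a, ha⟩ := IsIntegrallyClosed.algebraMap_eq_of_integral hb
    refine ⟨a, X.germToFunctionField_injective (f ⁻¹ᵁ V) ?_⟩
    rw [IsScalarTower.algebraMap_apply Γ(Y, V) Γ(X, f ⁻¹ᵁ V) X.functionField] at ha
    exact ha
  haveI : IsIso (f.app V) := (ConcreteCategory.isIso_iff_bijective _).mpr ⟨hinj, hsurj⟩
  exact isIso_morphismRestrict_of_isIso_app f V.2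

/-- **An integral birational morphism of integral schemes onto a normal scheme is an
isomorphism** (de Jong 1996, 4.16: "`Z'₁ → Y'` finite and birational […] Thus `Z'₁ → Y'` is an
isomorphism as `Y'` is normal"; likewise 4.20, 4.21). Over a non-empty affine open `V = Spec A`
of `Y`: `A` is an integrally closed domain, `f⁻¹(V) = Spec B` with `A → B` injective and
integral, and the stalk map at the generic point identifies `K(X)` with `K(Y) = Frac A`
compatibly with `A → B → K(X)`; so every element of `B`, integral over `A` inside `Frac A`, comes
from `A`, `A → B` is bijective and `f` is an isomorphism over `V`, hence over `Y`.
[cite: DeJong1996, 4.16, p. 71] -/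
theorem isIso_of_isIntegralHom_of_isBirational {X Y : Scheme.{u}} [IsIntegral X] [IsIntegral Y]
    (f : X ⟶ Y) [IsIntegralHom f] (hY : ∀ y : Y, IsIntegrallyClosed (Y.presheaf.stalk y))
    (hf : IsBirational f) : IsIso f := by
  haveI : IsDominant f := hf.isDominant
  have hstalk : IsIso (f.stalkMap (genericPoint X)) := hf.isIso_stalkMap_genericPoint
  -- being an isomorphism is local on the target: non-empty affine opens suffice
  have key : MorphismProperty.isomorphisms Scheme f := by
    refine (IsZariskiLocalAtTarget.iff_of_iSup_eq_top
      (P := MorphismProperty.isomorphisms Scheme) _ (iSup_nonempty_affineOpens_eq_top Y)).mpr ?_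
    rintro ⟨V, hVne⟩
    show IsIso (f ∣_ (V : Y.Opens))
    haveI := hVne
    exact isIso_morphismRestrict_of_isIntegralHom_of_isIso_stalkMap f hY hstalk V
  exact key

/-- **A finite birational morphism of integral schemes onto a normal scheme is an
isomorphism** — the form quoted by de Jong 1996 at 4.16, 4.20 ("Thus the finite birational
morphism `pr₂⁻¹(V) → V` is an isomorphism") and 4.21 ("Thus the birational finite morphism
`pr₁ : T → 𝒞` is an isomorphism"). [cite: DeJong1996, 4.20–4.21, pp. 73–74] -/
theorem isIso_of_isFinite_of_isBirational {X Y : Scheme.{u}} [IsIntegral X] [IsIntegral Y]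
    (f : X ⟶ Y) [IsFinite f] (hY : ∀ y : Y, IsIntegrallyClosed (Y.presheaf.stalk y))
    (hf : IsBirational f) : IsIso f :=
  isIso_of_isIntegralHom_of_isBirational f hY hf

end Literature.AlgebraicGeometry.Resolution

end
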